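import Summits.NavierStokesRegularity.NavierStokesRegularity.Theorems.LerayQuarterDissipationFiniteDissipationLiouvillePlanarityFloor
import Literature.Analysis.FluidPDE.BarkerPrange2020VorticityAlignmentTypeIHolds
import HarnessLib

/-!
# Crux `FiniteDissipationLiouville` (stmt-NavierStokesRegularity-22144): the LOCAL planarity
# leaf — a slice two-dimensional on ANY open set kills a finite-dissipation Type-I profile; the
# planarity floor holds in EVERY similarity ball

Theorems file of route `LerayQuarterDissipation` (lead prover ns-lqd-lead g8; `--supports` the
crux, line `birth`; portrait facts for the registered stub `stub_envelopeCriticalLiouville`).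
Navier–Stokes regularity is NOT proved by anything here; no summit is.

Localisation of `…PlanarityFloor` by the space analyticity of the slices
(`IsTypeIAncientMild.analyticOnNhd_slice_univ`, identity theorem):

* `slice_eq_zero_of_planar_on_open` — a member of `𝒟_{C,K}` with `∂ₑ w(s) = 0` (`e ≠ 0`) on SOME
  non-empty open set, at ONE instant, vanishes at that instant;
* `false_of_planar_seq_local`, `planarity_leaf_local` — **for all `C, K` and every similarity radius
  `r > 0` there is `δ = δ(C,K,r) > 0` such that ONE instant and ONE unit direction `e` with
  `(−t)‖∂ₑ w(t,x)‖ ≤ δ` on `B(0, r√(−t))` force boundedness at the apex**;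
* `planarity_floor_local` — **every singular member has, at EVERY instant, in EVERY similarity
  ball `B(0, r√(−t))` and for EVERY unit direction `e`, a point with `(−t)‖∂ₑ w‖ > δ(C,K,r)`**:
  non-planarity of a finite-dissipation Type-I singularity concentrates at the singular point.

HONEST FRAMING. `δ(C,K,r)` by compactness; portrait fact; no DSS scenario with three-dimensional
profile is removed. Nearest in-tree antecedent: the KNSS 2009 Thm 5.1 / 6.2 planar Liouville
theorems (`KNSS2009_typeI_rate_liouville_holds`, invariance along a line at ALL times); here ONE
slice, ONE ball, uniform tolerance.

References: Koch–Nadirashvili–Seregin–Šverák 2009, §4, Thm 5.1; Lemarié-Rieusset 2016, Thm. 9.12.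
-/

noncomputable section

-- the summit and its single sub-problem share the name (CONVENTIONS §1), as in every Theorems file
set_option linter.dupNamespace false

namespace Summit.NavierStokesRegularity.NavierStokesRegularity.Theorems.FiniteDissipationLiouville.Planarity

open MeasureTheory Set Filter Topology Metric Function
open Literature.Analysis Literature.Analysis.FluidPDE
open Summit.NavierStokesRegularity.NavierStokesRegularity.Theorems.FiniteDissipationLiouville
open scoped ENNReal NNReal RealInnerProductSpace

/-! ### Planarity on an open set -/

/-- **A member of `𝒟_{C,K}` with ONE slice two-dimensional on SOME non-empty open set vanishes at
that instant**: the directional derivative `∂ₑ w(s)` of the analytic slice is analytic and vanishes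
on the open set, hence everywhere (identity theorem); then
`slice_eq_zero_of_fderiv_apply_eq_zero`. [cite: LemarieRieusset2016, Thm. 9.12] [cite: KochNadirashviliSereginSverak2009, Thm 5.1 (arXiv:0709.3599 p. 9)] -/
theorem slice_eq_zero_of_planar_on_open {C K : ℝ}
    {w : ℝ → EuclideanSpace ℝ (Fin 3) → EuclideanSpace ℝ (Fin 3)}
    (hw : IsTypeIAncientMild C w)
    (hlaw : ∀ s : ℝ, s < 0 → ∫⁻ x, ‖fderiv ℝ (w s) x‖ₑ ^ 2 ≤ ENNReal.ofReal (K / Real.sqrt (-s)))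
    {s : ℝ} (hs : s < 0) {S : Set (EuclideanSpace ℝ (Fin 3))} (hS : IsOpen S) (hne : S.Nonempty)
    {e : EuclideanSpace ℝ (Fin 3)} (he : e ≠ 0) (hplanar : ∀ x ∈ S, fderiv ℝ (w s) x e = 0) :
    ∀ x, w s x = 0 := by
  have han : AnalyticOnNhd ℝ (w s) univ := hw.analyticOnNhd_slice_univ hs
  have hanD : AnalyticOnNhd ℝ (fun x => fderiv ℝ (w s) x e) univ :=
    (ContinuousLinearMap.apply ℝ (EuclideanSpace ℝ (Fin 3)) e).comp_analyticOnNhd han.fderiv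
  obtain ⟨z₀, hz₀⟩ := hne
  have hev : (fun x => fderiv ℝ (w s) x e) =ᶠ[𝓝 z₀] 0 :=
    eventuallyEq_of_mem (hS.mem_nhds hz₀) fun x hx => hplanar x hx
  have h0 : ∀ x, fderiv ℝ (w s) x e = 0 := fun x =>
    hanD.eqOn_zero_of_preconnected_of_eventuallyEq_zero isPreconnected_univ (mem_univ z₀) hev
      (mem_univ x)
  exact slice_eq_zero_of_fderiv_apply_eq_zero hw hlaw hs he h0

/-! ### The local compactness core -/

/-- **No sequence of singular members of `𝒟_{C,K}` is asymptotically two-dimensional on a FIXED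
ball `B(0,r)` at `t = −1`**: along a subsequence the unit directions converge, the gradients
converge pointwise, so the KNSS limit has `∂ₑ W(−1) = 0` on `B(0,r)`; by analyticity the slice is
two-dimensional, hence zero — contradicting persistence of the singularity.
[cite: KochNadirashviliSereginSverak2009, §4 (arXiv:0709.3599 p. 8)] -/
theorem false_of_planar_seq_local {C K r : ℝ} (hr : 0 < r)
    {w : ℕ → ℝ → EuclideanSpace ℝ (Fin 3) → EuclideanSpace ℝ (Fin 3)}
    (hwk : ∀ k, IsTypeIAncientMild C (w k))
    (hlaw : ∀ k, ∀ s : ℝ, s < 0 →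
      ∫⁻ x, ‖fderiv ℝ (w k s) x‖ₑ ^ 2 ≤ ENNReal.ofReal (K / Real.sqrt (-s)))
    (hsing : ∀ k, ∀ ρ > 0, ∀ M : ℝ, ∃ t ∈ Ioo (-(ρ ^ 2)) (0 : ℝ),
      ∃ x ∈ ball (0 : EuclideanSpace ℝ (Fin 3)) ρ, M < ‖w k t x‖)
    {e : ℕ → EuclideanSpace ℝ (Fin 3)} (he : ∀ k, ‖e k‖ = 1)
    (hplanar : ∀ k : ℕ, ∀ x ∈ ball (0 : EuclideanSpace ℝ (Fin 3)) r,
      ‖fderiv ℝ (w k (-1)) x (e k)‖ ≤ 1 / ((k : ℝ) + 1)) :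
    False := by
  obtain ⟨ψ, hψ, W, hW, hunif, -, hgrad⟩ := Compactness.seqLimit hwk
  have hψt : Tendsto ψ atTop atTop := hψ.tendsto_atTop
  have hWlaw : ∀ s : ℝ, s < 0 →
      ∫⁻ x, ‖fderiv ℝ (W s) x‖ₑ ^ 2 ≤ ENNReal.ofReal (K / Real.sqrt (-s)) :=
    Compactness.law_of_seqLimit (Kinf := K) (Kk := fun _ => K) hψt hlaw
      (fun ε hε => Eventually.of_forall fun _ => by linarith) hgrad
  have hWsing := Compactness.persistent_singularity_seq (w := fun j => w (ψ j))
    (fun j => hwk (ψ j)) (fun j => hlaw (ψ j)) (fun j => hsing (ψ j)) hW hunif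
  have h1 : (-1 : ℝ) < 0 := by norm_num
  have hsph : ∀ j, e (ψ j) ∈ sphere (0 : EuclideanSpace ℝ (Fin 3)) 1 := fun j =>
    mem_sphere_zero_iff_norm.2 (he (ψ j))
  obtain ⟨eL, heL, φ, hφ, hφt⟩ :=
    (isCompact_sphere (0 : EuclideanSpace ℝ (Fin 3)) 1).tendsto_subseq hsph
  have hφt' : Tendsto φ atTop atTop := hφ.tendsto_atTop
  have heL1 : ‖eL‖ = 1 := mem_sphere_zero_iff_norm.1 heL
  have heL0 : eL ≠ 0 := by
    intro h; rw [h, norm_zero] at heL1; exact zero_ne_one heL1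
  have hδ : Tendsto (fun j => 1 / ((ψ (φ j) : ℝ) + 1)) atTop (𝓝 0) :=
    (tendsto_one_div_add_atTop_nhds_zero_nat (𝕜 := ℝ)).comp (hψt.comp hφt')
  have hplane : ∀ z ∈ ball (0 : EuclideanSpace ℝ (Fin 3)) r, fderiv ℝ (W (-1)) z eL = 0 := by
    intro z hz
    have hDz : Tendsto (fun j => fderiv ℝ (w (ψ (φ j)) (-1)) z) atTop (𝓝 (fderiv ℝ (W (-1)) z)) :=
      (hgrad (-1) h1 z).comp hφt'
    have happ : Tendsto (fun j => fderiv ℝ (w (ψ (φ j)) (-1)) z (e (ψ (φ j)))) atTop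
        (𝓝 (fderiv ℝ (W (-1)) z eL)) :=
      ((isBoundedBilinearMap_apply (𝕜 := ℝ) (E := EuclideanSpace ℝ (Fin 3))
        (F := EuclideanSpace ℝ (Fin 3))).continuous.tendsto (fderiv ℝ (W (-1)) z, eL)).comp
        (hDz.prodMk_nhds hφt)
    have hle : ∀ j, ‖fderiv ℝ (w (ψ (φ j)) (-1)) z (e (ψ (φ j)))‖ ≤ 1 / ((ψ (φ j) : ℝ) + 1) :=
      fun j => hplanar (ψ (φ j)) z hz
    exact tendsto_nhds_unique happ (squeeze_zero_norm hle hδ)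
  exact CalmSlice.not_singular_of_zero_slice hW h1
    (slice_eq_zero_of_planar_on_open hW hWlaw h1 isOpen_ball ⟨0, mem_ball_self hr⟩ heL0 hplane)
    hWsing

/-! ### The local leaf and the local floor -/

/-- **LOCAL ONE-SLICE PLANARITY LEAF.** For all `C, K` and every similarity radius `r > 0` there is
`δ = δ(C,K,r) > 0` such that a member of `𝒟_{C,K}` having ONE instant `t < 0` and ONE unit
direction `e` with `(−t)‖∂ₑ w(t,x)‖ ≤ δ` for all `x ∈ B(0, r√(−t))` is bounded on some backward
cylinder at the origin. [cite: KochNadirashviliSereginSverak2009, §4 and Thm 5.1 (arXiv:0709.3599 pp. 8–9)] -/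
theorem planarity_leaf_local : ∀ (C K r : ℝ), 0 < r → ∃ δ > 0,
    ∀ (w : ℝ → EuclideanSpace ℝ (Fin 3) → EuclideanSpace ℝ (Fin 3)),
      IsTypeIAncientMild C w →
      (∀ s : ℝ, s < 0 → ∫⁻ x, ‖fderiv ℝ (w s) x‖ₑ ^ 2 ≤ ENNReal.ofReal (K / Real.sqrt (-s))) →
      (∃ t < 0, ∃ e : EuclideanSpace ℝ (Fin 3), ‖e‖ = 1 ∧
        ∀ x ∈ ball (0 : EuclideanSpace ℝ (Fin 3)) (r * Real.sqrt (-t)),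
          (-t) * ‖fderiv ℝ (w t) x e‖ ≤ δ) →
      ¬ (∀ ρ > 0, ∀ M : ℝ, ∃ t ∈ Ioo (-(ρ ^ 2)) (0 : ℝ),
        ∃ x ∈ ball (0 : EuclideanSpace ℝ (Fin 3)) ρ, M < ‖w t x‖) := by
  intro C K r hr
  by_contra hcon
  push Not at hcon
  choose w' hw' hlaw' hq' hsing' using hcon
  choose t' ht' e' he' hq' using hq'
  have hpos : ∀ k : ℕ, (0 : ℝ) < 1 / ((k : ℝ) + 1) := fun k => by positivity
  set w : ℕ → ℝ → EuclideanSpace ℝ (Fin 3) → EuclideanSpace ℝ (Fin 3) :=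
    fun k => w' _ (hpos k) with hw_def
  have hw : ∀ k, IsTypeIAncientMild C (w k) := fun k => hw' _ (hpos k)
  have hlaw := fun k => hlaw' _ (hpos k)
  have hsing := fun k => hsing' _ (hpos k)
  set t : ℕ → ℝ := fun k => t' _ (hpos k) with ht_def
  have ht : ∀ k, t k < 0 := fun k => ht' _ (hpos k)
  set e : ℕ → EuclideanSpace ℝ (Fin 3) := fun k => e' _ (hpos k) with he_def
  have he : ∀ k, ‖e k‖ = 1 := fun k => he' _ (hpos k)
  have hq := fun k => hq' _ (hpos k)
  set c : ℕ → ℝ := fun k => Real.sqrt (-t k) with hc_def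
  have hc : ∀ k, 0 < c k := fun k => Real.sqrt_pos.2 (neg_pos.2 (ht k))
  have hc2 : ∀ k, c k ^ 2 = -t k := fun k => Real.sq_sqrt (neg_nonneg.2 (ht k).le)
  set v : ℕ → ℝ → EuclideanSpace ℝ (Fin 3) → EuclideanSpace ℝ (Fin 3) :=
    fun k => nsRescale (c k) (w k) with hv_def
  have hv : ∀ k, IsTypeIAncientMild C (v k) := fun k => isTypeIAncientMild_nsRescale (hw k) (hc k)
  have hvlaw : ∀ k, ∀ s : ℝ, s < 0 →
      ∫⁻ x, ‖fderiv ℝ (v k s) x‖ₑ ^ 2 ≤ ENNReal.ofReal (K / Real.sqrt (-s)) :=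
    fun k => RecurrentReductionD.dissipationLaw_nsRescale (hlaw k) (hc k)
  have hvsing : ∀ k, ∀ ρ > 0, ∀ M : ℝ, ∃ t ∈ Ioo (-(ρ ^ 2)) (0 : ℝ),
      ∃ x ∈ ball (0 : EuclideanSpace ℝ (Fin 3)) ρ, M < ‖v k t x‖ :=
    fun k => RecurrentReductionD.singularAtOrigin_nsRescale (hsing k) (hc k)
  have e1 : ∀ k, c k ^ 2 * (-1 : ℝ) = t k := fun k => by rw [hc2]; ring
  have hball : ∀ k : ℕ, ∀ z ∈ ball (0 : EuclideanSpace ℝ (Fin 3)) r,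
      c k • z ∈ ball (0 : EuclideanSpace ℝ (Fin 3)) (r * Real.sqrt (-t k)) := by
    intro k z hz
    rw [mem_ball_zero_iff] at hz ⊢
    rw [norm_smul, Real.norm_of_nonneg (hc k).le, hc_def, mul_comm]
    exact mul_lt_mul_of_pos_right hz (hc k)
  have hplanar : ∀ k : ℕ, ∀ x ∈ ball (0 : EuclideanSpace ℝ (Fin 3)) r,
      ‖fderiv ℝ (v k (-1)) x (e k)‖ ≤ 1 / ((k : ℝ) + 1) := by
    intro k x hx
    rw [hv_def]
    dsimp only
    rw [RecurrentReductionD.fderiv_nsRescale, e1, FunLike.coe_smul, Pi.smul_apply, norm_smul,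
      Real.norm_of_nonneg (mul_self_nonneg _), ← sq, hc2]
    exact hq k (c k • x) (hball k x hx)
  exact false_of_planar_seq_local hr hv hvlaw hvsing he hplanar

/-- **LOCAL PLANARITY FLOOR** (portrait clause of the registered stub
`stub_envelopeCriticalLiouville`): for all `C, K` and every similarity radius `r > 0` there is
`δ = δ(C,K,r) > 0` such that every SINGULAR member of `𝒟_{C,K}` has, at EVERY instant `t < 0`
and for EVERY unit direction `e`, a point `x ∈ B(0, r√(−t))` with `δ < (−t)‖∂ₑ w(t,x)‖`.
[cite: KochNadirashviliSereginSverak2009, §4 and Thm 5.1 (arXiv:0709.3599 pp. 8–9)] -/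
theorem planarity_floor_local : ∀ (C K r : ℝ), 0 < r → ∃ δ > 0,
    ∀ (w : ℝ → EuclideanSpace ℝ (Fin 3) → EuclideanSpace ℝ (Fin 3)),
      IsTypeIAncientMild C w →
      (∀ s : ℝ, s < 0 → ∫⁻ x, ‖fderiv ℝ (w s) x‖ₑ ^ 2 ≤ ENNReal.ofReal (K / Real.sqrt (-s))) →
      (∀ ρ > 0, ∀ M : ℝ, ∃ t ∈ Ioo (-(ρ ^ 2)) (0 : ℝ),
        ∃ x ∈ ball (0 : EuclideanSpace ℝ (Fin 3)) ρ, M < ‖w t x‖) →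
      ∀ t < 0, ∀ e : EuclideanSpace ℝ (Fin 3), ‖e‖ = 1 →
        ∃ x ∈ ball (0 : EuclideanSpace ℝ (Fin 3)) (r * Real.sqrt (-t)),
          δ < (-t) * ‖fderiv ℝ (w t) x e‖ := by
  intro C K r hr
  obtain ⟨δ, hδ, h⟩ := planarity_leaf_local C K r hr
  refine ⟨δ, hδ, fun w hw hlaw hsing t ht e he => ?_⟩
  by_contra hcon
  push Not at hcon
  exact h w hw hlaw ⟨t, ht, e, he, hcon⟩ hsing

end Summit.NavierStokesRegularity.NavierStokesRegularity.Theorems.FiniteDissipationLiouville.Planarity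

end
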